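import Mathlib
import HarnessLib
import Summits.HubbardSuperconductivity.HubbardSuperconductivity.Theorems.KLProgrammeKLRegimeWickOrderedStep
import Literature.MathematicalPhysics.QuantumLattice.GrassmannLinearSubstitution
import Literature.MathematicalPhysics.QuantumLattice.GrassmannPairLaplacians
import Literature.MathematicalPhysics.QuantumLattice.GrassmannParity
import Literature.MathematicalPhysics.QuantumLattice.GrassmannWardIdentity
import Literature.MathematicalPhysics.QuantumLattice.GrassmannLaplacianPairWick

/-!
# Route `KLProgramme` — crux K3, gen-4 ENGINE child `KLRegimeEngineV12` (stmt-HubbardSuperconductivity-19855), (E2-v8):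
# WICK'S THEOREM FOR THE STAR PRODUCT — `a ⋆_C b` contracts ONLY BETWEEN `a` and `b` (cell gate-hubbard-kl, seat p1 g8)

Sequel to `…KLRegimeWickOrderedStep` (p481972: the Wick-smeared action `𝒲_n` moves by `−½(𝒲 ⋆_{D_n} 𝒲 − 𝒲 ⋆_{D_{n+1}} 𝒲) + e^{Δ}R₃`,
`wickStar C a b = e^{Δ_C}((e^{−Δ_C}a)(e^{−Δ_C}b))`).  This file proves the structural fact behind the Wick-ordered scheme
(HOME/p1/E2-STRUCTURE-NOTE.md §4): the star product has NO self-contractions.  Generic over a commutative `ℚ`-algebra `R` and a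
finite label type `Γ`; the device is the DOUBLED label set `Γ × Fin 2` (two independent copies of the fields) and the tree's
covariance calculus for linear substitutions (`GrassmannLinearSubstitution.gaussConv_map`) and supports
(`GrassmannPairLaplacians.grassmannLaplacian_mul_eq_mul_of_mem(_right)`):

* §1 the doubling: `dblCopy s : 𝒜(Γ) →ₐ 𝒜(Γ × Fin 2)` (`ψ(X) ↦ ψ(X,s)`), `dblFold : 𝒜(Γ × Fin 2) →ₐ 𝒜(Γ)` (`ψ(X,s) ↦ ψ(X)`),
  `dblFold ∘ dblCopy s = id`, `dblFold (dblCopy 0 a · dblCopy 1 b) = a·b`, supports and parity of the copies, the block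
  covariances `dblCov C s t` and the CROSS covariance `crossCov C = dblCov C 0 1 + dblCov C 1 0`;
* §2 transport: `e^{Δ_C} ∘ dblFold = dblFold ∘ e^{Δ_{C̃}}` with `C̃ = Σ_{s,t} dblCov C s t` (all four blocks `= C`), and
  `e^{Δ_{dblCov C' s s}}(dblCopy s a) = dblCopy s (e^{Δ_{C'}} a)`; `e^{Δ}` versions of the support lemmas;
* §3 **`wickStar_eq_dblFold_gaussConv_cross`**: for EVEN `a` and any `b`,
  `a ⋆_C b = dblFold (e^{Δ_{crossCov C}} (dblCopy 0 a · dblCopy 1 b))` — only the cross Laplacian (one leg in each factor) acts;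
* §4 **`grassmannLaplacian_crossCov_copy_mul_copy`**: the single cross contraction in closed form,
  `Δ_{crossCov C}(dblCopy 0 a · dblCopy 1 b) = Σ_{X,Y} contr C X Y • dblCopy 0 (involute (∂_X a)) · dblCopy 1 (∂_Y b)`
  (`contr C X Y = ½(C Y X − C X Y)` = `∫ψ(X)ψ(Y)dμ_C`), for ALL `a, b` — the generator of the `k`-fold cross contractions
  `e^{Δ_×} = Σ_k Δ_×^k/k!`; with `∂_X ∘ involute = −involute ∘ ∂_X` (`grassmannDeriv_involute`).

Consequence for the engine (E2-STRUCTURE-NOTE §4): the `2m`-leg kernel of `𝒲 ⋆_{D} 𝒲 − 𝒲 ⋆_{D'} 𝒲` collects exactly the two-vertex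
graphs with `k ≥ 1` lines BETWEEN the two copies of `𝒲`, line pairs from `D⊗D − D'⊗D'`; no line returns to its own vertex.
Everything is proved; definitions are the four doubling gadgets (bodies only); nothing about the model is asserted.

References: M. Salmhofer, *Renormalization* (1999) §2.2 (Wick ordering) and §4.3; J. Feldman, H. Knörrer, E. Trubowitz,
*Fermionic Functional Integrals and the Renormalization Group* (2002) §I.4 (Wick ordering `Ω_C`, products of Wick monomials).
-/

noncomputable section

namespace Summit.HubbardSuperconductivity.HubbardSuperconductivity.Theorems.KLRegimeWick

set_option linter.dupNamespace false -- summit = problem name (single-conjunct summit), D-0017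

open Literature.MathematicalPhysics.QuantumLattice GrassmannAlgebra Finset Matrix

section Doubling

variable (R : Type*) [CommRing R] {Γ : Type*} [Fintype Γ] [DecidableEq Γ]

/-! ## §1 The doubled label set `Γ × Fin 2` -/

/-- The matrix of the FOLD substitution `ψ(X,s) ↦ ψ(X)`: `P X (Y,t) = [X = Y]`. -/
def dblProjMat : Matrix Γ (Γ × Fin 2) R := Matrix.of fun X q => if X = q.1 then 1 else 0

/-- The matrix of the COPY-`s` substitution `ψ(X) ↦ ψ(X,s)`: `E_s (Y,t) X = [(Y,t) = (X,s)]`. -/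
def dblEmbMat (s : Fin 2) : Matrix (Γ × Fin 2) Γ R := Matrix.of fun p X => if p = (X, s) then 1 else 0

/-- **Fold** `𝒜(Γ × Fin 2) →ₐ 𝒜(Γ)`: both copies of a field are identified, `ψ(X,s) ↦ ψ(X)`. -/
def dblFold : GrassmannAlgebra R (Γ × Fin 2) →ₐ[R] GrassmannAlgebra R Γ :=
  ExteriorAlgebra.map (Matrix.toLin' (dblProjMat R (Γ := Γ)))

/-- **Copy `s`** `𝒜(Γ) →ₐ 𝒜(Γ × Fin 2)`: `ψ(X) ↦ ψ(X,s)`. -/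
def dblCopy (s : Fin 2) : GrassmannAlgebra R Γ →ₐ[R] GrassmannAlgebra R (Γ × Fin 2) :=
  ExteriorAlgebra.map (Matrix.toLin' (dblEmbMat R (Γ := Γ) s))

/-- The `(s,t)` BLOCK of a covariance on the doubled labels: `(dblCov C s t) (X,s') (Y,t') = [s' = s][t' = t] C X Y`. -/
def dblCov (C : Matrix Γ Γ R) (s t : Fin 2) : Matrix (Γ × Fin 2) (Γ × Fin 2) R :=
  Matrix.of fun p q => if p.2 = s ∧ q.2 = t then C p.1 q.1 else 0

/-- The **cross covariance** on the doubled labels: `C` between different copies, `0` within a copy. -/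
def crossCov (C : Matrix Γ Γ R) : Matrix (Γ × Fin 2) (Γ × Fin 2) R := dblCov R C 0 1 + dblCov R C 1 0

omit [Fintype Γ] [DecidableEq Γ] in
/-- Entries of `dblCov`. -/
@[simp] theorem dblCov_apply (C : Matrix Γ Γ R) (s t : Fin 2) (p q : Γ × Fin 2) :
    dblCov R C s t p q = if p.2 = s ∧ q.2 = t then C p.1 q.1 else 0 := rfl

/-- `P · E_s = 1`: folding after copying is the identity substitution. -/
theorem dblProjMat_mul_dblEmbMat (s : Fin 2) :
    (dblProjMat R (Γ := Γ) * dblEmbMat R (Γ := Γ) s : Matrix Γ Γ R) = 1 := by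
  ext X Y
  simp only [Matrix.mul_apply, dblProjMat, dblEmbMat, Matrix.of_apply, mul_ite, mul_one, mul_zero,
    Matrix.one_apply]
  rw [Finset.sum_ite_eq' Finset.univ (Y, s)]
  simp

/-- `dblFold (dblCopy s a) = a`. -/
theorem dblFold_dblCopy (s : Fin 2) (a : GrassmannAlgebra R Γ) : dblFold R (dblCopy R s a) = a := by
  have h : (dblFold R (Γ := Γ)).comp (dblCopy R s) = AlgHom.id R _ := by
    rw [dblFold, dblCopy, ExteriorAlgebra.map_comp_map, ← Matrix.toLin'_mul, dblProjMat_mul_dblEmbMat,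
      Matrix.toLin'_one, ExteriorAlgebra.map_id]
  exact congrArg (fun φ : GrassmannAlgebra R Γ →ₐ[R] GrassmannAlgebra R Γ => φ a) h

/-- **`dblFold (dblCopy 0 a · dblCopy 1 b) = a · b`**: the product is the fold of the two-copy tensor. -/
theorem dblFold_copy_mul_copy (a b : GrassmannAlgebra R Γ) :
    dblFold R (dblCopy R 0 a * dblCopy R 1 b) = a * b := by
  rw [map_mul, dblFold_dblCopy, dblFold_dblCopy]

/-- The copy map on a generator: `dblCopy s (ψ(X)) = ψ(X,s)`. -/
theorem dblCopy_gen (s : Fin 2) (X : Γ) : dblCopy R s (gen R X) = gen R (X, s) := by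
  rw [dblCopy, gen, ExteriorAlgebra.map_apply_ι, gen, Matrix.toLin'_apply, Matrix.mulVec_single]
  congr 1
  ext p
  simp only [MulOpposite.op_one, Pi.smul_apply, Matrix.col_apply, dblEmbMat, Matrix.of_apply, one_smul,
    Pi.single_apply]

/-- The copy `s` of any element is supported on the labels of copy `s`. -/
theorem dblCopy_mem_fieldSubalgebra (s : Fin 2) (a : GrassmannAlgebra R Γ) :
    dblCopy R s a ∈ fieldSubalgebra R {p : Γ × Fin 2 | p.2 = s} := by
  induction a using ExteriorAlgebra.induction with
  | algebraMap r => rw [AlgHom.commutes]; exact Subalgebra.algebraMap_mem _ r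
  | ι v =>
    have hv : (ExteriorAlgebra.ι R v : GrassmannAlgebra R Γ) = ∑ X, v X • gen R X := by
      conv_lhs => rw [show v = ∑ X, v X • (Pi.single X 1 : Γ → R) from by
        ext Y; simp [Finset.sum_apply, Pi.single_apply]]
      rw [map_sum]
      simp only [map_smul, gen]
    rw [hv, map_sum]
    refine Subalgebra.sum_mem _ fun X _ => ?_
    rw [map_smul, dblCopy_gen]
    exact Subalgebra.smul_mem _ (gen_mem_fieldSubalgebra R (by exact rfl)) _
  | mul a b ha hb => rw [map_mul]; exact Subalgebra.mul_mem _ ha hb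
  | add a b ha hb => rw [map_add]; exact Subalgebra.add_mem _ ha hb

/-- Copies of even elements are even. -/
theorem dblCopy_mem_evenOdd_zero (s : Fin 2) {a : GrassmannAlgebra R Γ} (ha : a ∈ evenOdd R 0) :
    dblCopy R s a ∈ evenOdd R 0 :=
  map_mem_evenOdd_zero R _ ha

/-! ## §2 Transport of the Gaussian convolution through fold and copy -/

/-- The fold pulls a covariance back to ALL FOUR blocks: `Pᵀ C P = Σ_{s,t} dblCov C s t`. -/
theorem dblProjMat_transpose_mul_mul (C : Matrix Γ Γ R) :
    ((dblProjMat R (Γ := Γ)).transpose * C * dblProjMat R (Γ := Γ) : Matrix (Γ × Fin 2) (Γ × Fin 2) R) =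
      dblCov R C 0 0 + dblCov R C 1 1 + crossCov R C := by
  ext p q
  rw [Matrix.mul_apply]
  simp only [Matrix.mul_apply, Matrix.transpose_apply, dblProjMat, Matrix.of_apply, crossCov, Matrix.add_apply,
    dblCov_apply, ite_mul, one_mul, zero_mul, mul_ite, mul_one, mul_zero, Finset.mem_univ,
    if_true, Finset.sum_ite_eq']
  rcases p with ⟨X, s⟩; rcases q with ⟨Y, t⟩
  fin_cases s <;> fin_cases t <;> simp

/-- A copy pulls a doubled covariance back to its diagonal block: `E_sᵀ C' E_s = C'|_{(·,s),(·,s)}`. -/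
theorem dblEmbMat_transpose_mul_mul (s : Fin 2) (C' : Matrix (Γ × Fin 2) (Γ × Fin 2) R) :
    ((dblEmbMat R (Γ := Γ) s).transpose * C' * dblEmbMat R (Γ := Γ) s : Matrix Γ Γ R) =
      Matrix.of fun X Y => C' (X, s) (Y, s) := by
  ext X Y
  rw [Matrix.mul_apply]
  simp only [Matrix.mul_apply, Matrix.transpose_apply, dblEmbMat, Matrix.of_apply, ite_mul, one_mul, zero_mul,
    mul_ite, mul_one, mul_zero, Finset.sum_ite_eq', Finset.mem_univ, if_true]

/-- … in particular the block `dblCov C s s` pulls back to `C`. -/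
theorem dblEmbMat_transpose_mul_dblCov_mul (s : Fin 2) (C : Matrix Γ Γ R) :
    ((dblEmbMat R (Γ := Γ) s).transpose * dblCov R C s s * dblEmbMat R (Γ := Γ) s : Matrix Γ Γ R) = C := by
  rw [dblEmbMat_transpose_mul_mul]
  ext X Y
  simp

variable [Algebra ℚ R]

/-- **`e^{Δ_C} (dblFold F) = dblFold (e^{Δ_{C̃}} F)`**, `C̃ = dblCov C 0 0 + dblCov C 1 1 + crossCov C`. -/
theorem gaussConv_dblFold (C : Matrix Γ Γ R) (F : GrassmannAlgebra R (Γ × Fin 2)) :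
    gaussConv R C (dblFold R F) =
      dblFold R (gaussConv R (dblCov R C 0 0 + dblCov R C 1 1 + crossCov R C) F) := by
  rw [dblFold, gaussConv_map, LinearMap.toMatrix'_toLin', dblProjMat_transpose_mul_mul]

/-- **`e^{Δ_{dblCov C s s}} (dblCopy s a) = dblCopy s (e^{Δ_C} a)`**: the diagonal block acts on its own copy as `C`. -/
theorem gaussConv_dblCov_dblCopy (s : Fin 2) (C : Matrix Γ Γ R) (a : GrassmannAlgebra R Γ) :
    gaussConv R (dblCov R C s s) (dblCopy R s a) = dblCopy R s (gaussConv R C a) := by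
  rw [dblCopy, gaussConv_map, LinearMap.toMatrix'_toLin', dblEmbMat_transpose_mul_dblCov_mul]

/-- `e^{Δ_{C'}} (a b) = a · e^{Δ_{C'}} b` for an even `a` supported on `S` and `C'` charging no label of `S`. -/
theorem gaussConv_mul_eq_mul_of_mem {Γ' : Type*} [Fintype Γ'] [DecidableEq Γ'] (C' : Matrix Γ' Γ' R) {S : Set Γ'}
    (hC : ∀ X Y, X ∈ S ∨ Y ∈ S → C' X Y = 0) {a : GrassmannAlgebra R Γ'} (ha : a ∈ fieldSubalgebra R S)
    (ha0 : a ∈ evenOdd R 0) (b : GrassmannAlgebra R Γ') : gaussConv R C' (a * b) = a * gaussConv R C' b := by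
  obtain ⟨k, hk⟩ := isNilpotent_grassmannLaplacian R C'
  have hpow : ∀ n : ℕ, (grassmannLaplacian R C' ^ n) (a * b) = a * (grassmannLaplacian R C' ^ n) b := by
    intro n
    induction n with
    | zero => simp
    | succ n ih => rw [pow_succ', Module.End.mul_apply, ih, grassmannLaplacian_mul_eq_mul_of_mem R C' hC ha ha0,
        Module.End.mul_apply]
  rw [gaussConv_def, IsNilpotent.exp_eq_sum hk]
  simp only [LinearMap.coe_sum, Finset.sum_apply, LinearMap.smul_apply, hpow, Finset.mul_sum, mul_smul_comm]

/-- `e^{Δ_{C'}} (a b) = (e^{Δ_{C'}} a) · b` for `b` supported on `S` and `C'` charging no label of `S`. -/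
theorem gaussConv_mul_eq_mul_of_mem_right {Γ' : Type*} [Fintype Γ'] [DecidableEq Γ'] (C' : Matrix Γ' Γ' R) {S : Set Γ'}
    (hC : ∀ X Y, X ∈ S ∨ Y ∈ S → C' X Y = 0) (a : GrassmannAlgebra R Γ') {b : GrassmannAlgebra R Γ'}
    (hb : b ∈ fieldSubalgebra R S) : gaussConv R C' (a * b) = gaussConv R C' a * b := by
  obtain ⟨k, hk⟩ := isNilpotent_grassmannLaplacian R C'
  have hpow : ∀ n : ℕ, (grassmannLaplacian R C' ^ n) (a * b) = (grassmannLaplacian R C' ^ n) a * b := by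
    intro n
    induction n with
    | zero => simp
    | succ n ih => rw [pow_succ', Module.End.mul_apply, ih, grassmannLaplacian_mul_eq_mul_of_mem_right R C' hC _ hb,
        Module.End.mul_apply]
  rw [gaussConv_def, IsNilpotent.exp_eq_sum hk]
  simp only [LinearMap.coe_sum, Finset.sum_apply, LinearMap.smul_apply, hpow, Finset.sum_mul, smul_mul_assoc]

omit [Fintype Γ] [DecidableEq Γ] [Algebra ℚ R] in
/-- The block `dblCov C t t` charges no label of the other copy `s ≠ t`. -/
theorem dblCov_eq_zero_of_mem {s t : Fin 2} (hst : s ≠ t) (C : Matrix Γ Γ R) (p q : Γ × Fin 2)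
    (h : p ∈ {p : Γ × Fin 2 | p.2 = s} ∨ q ∈ {p : Γ × Fin 2 | p.2 = s}) : dblCov R C t t p q = 0 := by
  simp only [Set.mem_setOf_eq] at h
  rw [dblCov_apply, if_neg]
  rintro ⟨hp, hq⟩
  rcases h with h | h
  · exact hst (h.symm.trans hp)
  · exact hst (h.symm.trans hq)

/-! ## §3 Wick's theorem for the star product: only cross contractions -/

/-- **`wickStar_eq_dblFold_gaussConv_cross`** — the Wick star product contracts only BETWEEN its factors: for even `a`,
`a ⋆_C b = dblFold (e^{Δ_{crossCov C}} (dblCopy 0 a · dblCopy 1 b))`.  (The diagonal blocks of the folded covariance undo the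
two `e^{−Δ_C}`; what is left is the cross block.) -/
theorem wickStar_eq_dblFold_gaussConv_cross (C : Matrix Γ Γ R) {a : GrassmannAlgebra R Γ} (ha : a ∈ evenOdd R 0)
    (b : GrassmannAlgebra R Γ) :
    wickStar R C a b = dblFold R (gaussConv R (crossCov R C) (dblCopy R 0 a * dblCopy R 1 b)) := by
  have h01 : (0 : Fin 2) ≠ 1 := by decide
  set a' := gaussConv R (-C) a with ha'
  set b' := gaussConv R (-C) b with hb'
  have ha'0 : a' ∈ evenOdd R 0 := gaussConv_mem_evenOdd R (-C) ha
  -- lift the product to the doubled algebra and transport `e^{Δ_C}` through the fold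
  rw [wickStar, ← dblFold_copy_mul_copy R a' b', gaussConv_dblFold, add_comm (dblCov R C 0 0 + dblCov R C 1 1),
    gaussConv_add_apply, gaussConv_add_apply]
  -- the block `11` acts on copy `1` only and undoes `e^{-Δ_C}` on `b`
  rw [gaussConv_mul_eq_mul_of_mem R (dblCov R C 1 1) (fun p q h => dblCov_eq_zero_of_mem R h01 C p q h)
      (dblCopy_mem_fieldSubalgebra R 0 a') (dblCopy_mem_evenOdd_zero R 0 ha'0),
    gaussConv_dblCov_dblCopy, hb', gaussConv_gaussConv_neg_apply]
  -- the block `00` acts on copy `0` only and undoes `e^{-Δ_C}` on `a`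
  rw [gaussConv_mul_eq_mul_of_mem_right R (dblCov R C 0 0) (fun p q h => dblCov_eq_zero_of_mem R h01.symm C p q h) _
      (dblCopy_mem_fieldSubalgebra R 1 b),
    gaussConv_dblCov_dblCopy, ha', gaussConv_gaussConv_neg_apply]

omit [DecidableEq Γ] in
/-- **No contractions with a constant**: `1 ⋆_C b = b`. -/
theorem wickStar_one_left (C : Matrix Γ Γ R) (b : GrassmannAlgebra R Γ) : wickStar R C 1 b = b := by
  rw [wickStar, gaussConv_one, one_mul, gaussConv_gaussConv_neg_apply]

omit [DecidableEq Γ] in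
/-- `a ⋆_C 1 = a`. -/
theorem wickStar_one_right (C : Matrix Γ Γ R) (a : GrassmannAlgebra R Γ) : wickStar R C a 1 = a := by
  rw [wickStar, gaussConv_one, mul_one, gaussConv_gaussConv_neg_apply]

/-! ## §4 The single cross contraction in closed form -/

omit [Fintype Γ] [DecidableEq Γ] [Algebra ℚ R] in
/-- **`∂_X ∘ involute = −involute ∘ ∂_X`** (the derivative lowers the degree by one). -/
theorem grassmannDeriv_involute {Γ' : Type*} (X : Γ') (a : GrassmannAlgebra R Γ') :
    grassmannDeriv R X (CliffordAlgebra.involute a) = -CliffordAlgebra.involute (grassmannDeriv R X a) := by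
  induction a using CliffordAlgebra.left_induction with
  | algebraMap r => rw [AlgHom.commutes, grassmannDeriv_algebraMap, map_zero, neg_zero]
  | add x y hx hy => rw [map_add, map_add, hx, hy, map_add, map_add, neg_add]
  | ι_mul x v hx =>
    rw [map_mul, CliffordAlgebra.involute_ι, neg_mul, map_neg, grassmannDeriv_ι_mul, hx, grassmannDeriv_ι_mul,
      map_sub, map_smul, map_mul, CliffordAlgebra.involute_ι]
    simp only [mul_neg, neg_mul, sub_neg_eq_add, neg_add]

omit [Algebra ℚ R] in
/-- The copy maps commute with the parity automorphism. -/
theorem involute_dblCopy (s : Fin 2) (a : GrassmannAlgebra R Γ) :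
    CliffordAlgebra.involute (dblCopy R s a) = dblCopy R s (CliffordAlgebra.involute a) := by
  induction a using ExteriorAlgebra.induction with
  | algebraMap r => simp only [AlgHom.commutes]
  | ι v =>
    rw [involute_ι_eq, map_neg, dblCopy, ExteriorAlgebra.map_apply_ι]
    exact involute_ι_eq R _
  | mul a b ha hb => rw [map_mul, map_mul, ha, hb, map_mul, map_mul]
  | add a b ha hb => rw [map_add, map_add, ha, hb, map_add, map_add]

omit [Algebra ℚ R] in
/-- Chain rule for the copy maps: `∂_{(X,t)} (dblCopy s a) = [t = s] dblCopy s (∂_X a)`. -/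
theorem grassmannDeriv_dblCopy (s t : Fin 2) (X : Γ) (a : GrassmannAlgebra R Γ) :
    grassmannDeriv R (X, t) (dblCopy R s a) = if t = s then dblCopy R s (grassmannDeriv R X a) else 0 := by
  rw [dblCopy, grassmannDeriv_map, LinearMap.toMatrix'_toLin']
  simp only [dblEmbMat, Matrix.of_apply, Prod.mk.injEq, ite_smul, one_smul, zero_smul]
  by_cases ht : t = s
  · rw [if_pos ht]
    rw [Finset.sum_eq_single X (fun Y _ hY => by rw [if_neg (fun h => hY h.1.symm)]) (fun h => absurd (mem_univ X) h),
      if_pos ⟨rfl, ht⟩]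
  · rw [if_neg ht]
    exact Finset.sum_eq_zero fun Y _ => by rw [if_neg (fun h => ht h.2)]

/-- **The single cross contraction**: for all `a, b`,
`Δ_{crossCov C}(dblCopy 0 a · dblCopy 1 b) = Σ_{X,Y} contr C X Y • dblCopy 0 (involute (∂_X a)) · dblCopy 1 (∂_Y b)`,
`contr C X Y = ½(C Y X − C X Y)` the two-point function of `dμ_C`. -/
theorem grassmannLaplacian_crossCov_copy_mul_copy (C : Matrix Γ Γ R) (a b : GrassmannAlgebra R Γ) :
    grassmannLaplacian R (crossCov R C) (dblCopy R 0 a * dblCopy R 1 b) =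
      ∑ X, ∑ Y, contr R C X Y • (dblCopy R 0 (CliffordAlgebra.involute (grassmannDeriv R X a)) *
        dblCopy R 1 (grassmannDeriv R Y b)) := by
  have h01 : (0 : Fin 2) ≠ 1 := by decide
  -- derivatives of the product
  have hA1 : ∀ Y, grassmannDeriv R (Y, (1 : Fin 2)) (dblCopy R 0 a * dblCopy R 1 b) =
      CliffordAlgebra.involute (dblCopy R 0 a) * dblCopy R 1 (grassmannDeriv R Y b) := by
    intro Y
    rw [grassmannDeriv_mul, grassmannDeriv_dblCopy, if_neg h01.symm, zero_mul, zero_add, grassmannDeriv_dblCopy,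
      if_pos rfl]
  have hA0 : ∀ Y, grassmannDeriv R (Y, (0 : Fin 2)) (dblCopy R 0 a * dblCopy R 1 b) =
      dblCopy R 0 (grassmannDeriv R Y a) * dblCopy R 1 b := by
    intro Y
    rw [grassmannDeriv_mul, grassmannDeriv_dblCopy, if_pos rfl, grassmannDeriv_dblCopy, if_neg h01, mul_zero,
      add_zero]
  have h01' : ∀ X Y, grassmannDeriv R (X, (0 : Fin 2)) (grassmannDeriv R (Y, (1 : Fin 2)) (dblCopy R 0 a * dblCopy R 1 b)) =
      -(dblCopy R 0 (CliffordAlgebra.involute (grassmannDeriv R X a)) * dblCopy R 1 (grassmannDeriv R Y b)) := by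
    intro X Y
    rw [hA1, involute_dblCopy, grassmannDeriv_mul, grassmannDeriv_dblCopy, if_pos rfl, grassmannDeriv_involute,
      grassmannDeriv_dblCopy, if_neg h01, mul_zero, add_zero, map_neg, neg_mul]
  have h10' : ∀ X Y, grassmannDeriv R (X, (1 : Fin 2)) (grassmannDeriv R (Y, (0 : Fin 2)) (dblCopy R 0 a * dblCopy R 1 b)) =
      dblCopy R 0 (CliffordAlgebra.involute (grassmannDeriv R Y a)) * dblCopy R 1 (grassmannDeriv R X b) := by
    intro X Y
    rw [hA0, grassmannDeriv_mul, grassmannDeriv_dblCopy, if_neg h01.symm, zero_mul, zero_add, involute_dblCopy,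
      grassmannDeriv_dblCopy, if_pos rfl]
  -- expand the Laplacian over the doubled labels
  rw [grassmannLaplacian_apply]
  simp only [Fintype.sum_prod_type, Fin.sum_univ_two, crossCov, Matrix.add_apply, dblCov_apply, h01, h01.symm,
    and_true, and_false, if_false, if_true, zero_add, add_zero, zero_smul, h01', h10', smul_neg]
  -- collect: `½ Σ_X Σ_Y (−C X Y + C Y X) • T X Y`
  rw [Finset.sum_add_distrib,
    Finset.sum_comm (f := fun X Y => C X Y • (dblCopy R 0 (CliffordAlgebra.involute (grassmannDeriv R Y a)) *
      dblCopy R 1 (grassmannDeriv R X b))),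
    ← Finset.sum_add_distrib, Finset.smul_sum]
  refine Finset.sum_congr rfl fun X _ => ?_
  rw [← Finset.sum_add_distrib, Finset.smul_sum]
  refine Finset.sum_congr rfl fun Y _ => ?_
  rw [contr_apply, smul_add, smul_neg, smul_smul, smul_smul, neg_add_eq_sub, mul_sub, sub_smul]

end Doubling

end Summit.HubbardSuperconductivity.HubbardSuperconductivity.Theorems.KLRegimeWick

end
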